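import Mathlib.Analysis.Complex.ReImTopology
import Mathlib.Topology.MetricSpace.Thickening
import Literature.Probability.RandomPlanarGeometry.ConformalRestriction
import Literature.Probability.RandomPlanarGeometry.CritPercSLE
import HarnessLib

/-!
# Conformal restriction, the chordal case: reduction of `Literature.Probability.RandomPlanarGeometry.LawlerSchrammWerner2003` to its parts

`Literature.Probability.RandomPlanarGeometry.LawlerSchrammWerner2003` (file `ConformalRestriction`) is result 2 of p. 5 of

* G. F. Lawler, O. Schramm, W. Werner, *Conformal restriction: the chordal case*, J. Amer. Math.
  Soc. **16** (2003) 917–955, arXiv:math/0209343 — below **[LSW]**, arXiv page numbers —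

"The only measure `P_α` that is supported on simple curves is `P_{5/8}`. It is the law of chordal
SLE_{8/3}", transposed to chordal curve families on Dobrushin domains. In the paper it is
assembled from

* Lemma 3.2 (p. 10): a probability measure on `Ω` is determined by `A ↦ P[K ∩ A = ∅]`, `A ∈ 𝒬*`;
* Prop. 3.3 / Def. 3.4 (pp. 10–11): for a probability measure `P` on `Ω`, TFAE (1) `P` is
  dilation-invariant and `𝒜₁`-covariant, (2) `𝒜`-covariant, (3) `∃ α > 0`,
  `P[K ∩ A = ∅] = Φ'_A(0)^α` for all `A ∈ 𝒬*`, (4) the same for all smooth hulls; and for each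
  `α` there is at most one such `P =: P_α`;
* Thm. 6.1 (p. 23): for the SLE_{8/3} path `γ` and `A ∈ 𝒬*`, `P[γ[0,∞) ∩ A = ∅] = Φ'_A(0)^{5/8}`,
  "the law of `γ(0, ∞)` is therefore `P_{5/8}`" (with [42] = Rohde–Schramm: SLE_{8/3} is a
  simple curve);
* Thm. 7.3 (p. 29): for `α > 5/8`, `P_α` is SLE_κ plus a Poisson cloud of filled Brownian
  bubbles, hence is not carried by simple curves; Cor. 8.6 (p. 37): `P_α` does not exist for
  `α < 5/8`.

This is a theory (Loewner chains, an Itô computation for `h_t'(W_t)^{5/8}`, SLE(κ, ρ), Brownian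
bubbles, plus the Riemann mapping theorem and Carathéodory's theorem for the transposition), so
the fact is DECOMPOSED here (literature-prover protocol for XL facts). This file

1. names the transposed vocabulary: `MarkedDomain.IsHullSubdomain D D'` (the sub-Dobrushin-domains
   `D' = φ(ℍ ∖ A)`, `A ∈ 𝒬*`: same marked points, `D ∖ D'` bounded away from both of them),
   `ChordalFamily.IsHullRestriction` ([LSW]'s `𝒜₁`-covariance = two-sided restriction, over hull
   subdomains only — the paper's hypothesis, WEAKER than the tree's `ChordalFamily.IsRestriction`,
   which allows pinching at the marked points), `ChordalFamily.IsCarriedBySimpleCurves`;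
2. vendors the two deep halves of result 2 as named facts in that vocabulary:
   `Literature.Probability.RandomPlanarGeometry.LawlerSchrammWerner2003_unique` (uniqueness: Prop. 3.3 with Lemma 3.2, Thm. 7.3,
   Cor. 8.6) and `Literature.Probability.RandomPlanarGeometry.IsSLELaw.hullRestriction_eightThirds` (Thm. 6.1, restriction for
   SLE_{8/3}; its half-plane form, Thm. 6.1 verbatim, is `Literature.Probability.RandomPlanarGeometry.sle_restriction_eightThirds` in
   `RestrictionHulls`);
3. PROVES the three properties of the SLE laws the assembly needs — `IsSLELaw.ae_endpoints`
   (curves run from `a` to `b` inside `D̄`; from Carathéodory's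
   `JordanDomain.mapsTo_boundaryExtension`), `IsSLELaw.ae_simple` (for `0 < κ ≤ 4` the curve is
   simple and meets `∂D` only at `a`, `b`; from Rohde–Schramm's
   `CritPerc.ae_isSimpleTrace_sleTrace_of_le_four` and the Borel measurability of the simple
   curves `CurveClass.measurableSet_simple`) and the conformal covariance of the SLE_κ laws
   between Dobrushin domains (`IsSLELaw.conformalCovariance`, kept as a named `Prop`, proved in
   `IsSLELaw.conformalCovariance_of_facts` from the tree's `IsSLECurve.map_eq` and Carathéodory's
   `JordanDomain.exists_hasBoundaryValue`, through `IsSLECurve.map`: the conformal image of an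
   SLE random curve is an SLE random curve) — together with the continuity of push-forwards
   `CurveClass.continuous_map` and two Borel-measurability lemmas on curve space
   (`CurveClass.isOpen_rangeSubset`, `CurveClass.measurableSet_range_inter_subset`);
4. PROVES the assembly `Literature.Probability.RandomPlanarGeometry.LawlerSchrammWerner2003_of_facts`: the two [LSW] facts, together
   with the tree's `exists_isSLECurve`, `IsSLECurve.map_eq`, Rohde–Schramm simplicity,
   Carathéodory and measurability facts, imply `Literature.Probability.RandomPlanarGeometry.LawlerSchrammWerner2003` verbatim.

What remains for `LawlerSchrammWerner2003_holds` is recorded fact by fact in the docstrings.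

## Transposition dictionary (used in every docstring below)

Fix a Dobrushin domain `(D; a, b)` and a chordal uniformizing map `φ : ℍ → D` (`0 ↦ a`, `∞ ↦ b`,
a homeomorphism `ℍ̄ ∪ {∞} → D̄` by Carathéodory). Hulls `A ∈ 𝒬*` ([LSW] §2, pp. 7–8: `A` bounded,
`A = cl(A ∩ ℍ)`, `ℍ ∖ A` simply connected, `0 ∉ A`) with `ℍ ∖ A` a Jordan domain of the sphere
(this includes all smooth hulls, [LSW] §2 p. 8, which suffice in Prop. 3.3 (4) and, by Lemma 2.1
approximation, generate the `𝒜₁`-covariance for all of `𝒬*`) correspond exactly to the hull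
subdomains `D' = φ(ℍ ∖ A)` of `D` (`IsHullSubdomain`: `A` bounded ⟺ `b ∉ cl(D ∖ D')`,
`0 ∉ A` ⟺ `a ∉ cl(D ∖ D')`). The event `{K ∩ A = ∅}` corresponds to
`CurveClass.rangeSubset (closure D')` up to the event "the curve touches `∂D' ∩ D` without
entering `D ∖ D̄'`", which is null for every law carried by simple curves meeting `∂D'` only at
the marked points and satisfying the restriction identity (apply the identity to that event), and
null for SLE_{8/3} by Thm. 6.1 and continuity of `A ↦ Φ'_A(0)` under exhaustion of `A°`.
[LSW]'s covariance "law of `K` on `{K ∩ A = ∅}` = `P[K ∩ A = ∅]` · law of `Φ_A⁻¹(K)`" (§2 p. 9)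
becomes, once the image law is identified with the family's own law in `D'` by conformal
covariance, the product identity `P D' (T) · P D {γ ⊆ D̄'} = P D (T ∩ {γ ⊆ D̄'})`.
-/

noncomputable section

open Set Filter Topology MeasureTheory
open UpperHalfPlane (upperHalfPlaneSet)
open scoped NNReal unitInterval

namespace Literature.Probability.RandomPlanarGeometry

/-! ### Push-forward of curves along a continuous map is continuous -/

section MapContinuous

variable {E F : Type*} [PseudoMetricSpace E] [PseudoMetricSpace F]

/-- Pushing curves forward along a continuous map `f` is continuous for the reparametrisation
distance: `f` is uniformly continuous AT the compact trace of `γ₁` (Heine–Cantor in the form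
`IsCompact.uniformContinuousAt_of_continuousAt`: `f x` is close to `f y` for `x` on the trace and
`y` close to `x`, `y` arbitrary), and a curve close to `γ₁` has, after reparametrisation, all its
points close to the corresponding points of `γ₁` (Aizenman–Burchard 1999, §2.1). [folklore] -/
theorem Curve.continuous_map (f : C(E, F)) : Continuous (Curve.map f) := by
  rw [Metric.continuous_iff]
  intro γ₁ ε hε
  have hK := γ₁.isCompact_range.uniformContinuousAt_of_continuousAt f
    (fun a _ ↦ f.continuous.continuousAt) (Metric.dist_mem_uniformity (half_pos hε))
  obtain ⟨δ, hδ, hδε⟩ := Metric.mem_uniformity_dist.1 hK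
  refine ⟨δ, hδ, fun γ₂ hγ ↦ ?_⟩
  rw [dist_comm] at hγ ⊢
  obtain ⟨φ, hφ⟩ := Curve.exists_dist_reparam_lt hγ
  refine lt_of_le_of_lt ?_ (half_lt_self hε)
  refine (Curve.reparamDist_le _ _ φ).trans ((ContinuousMap.dist_le (half_pos hε).le).2 fun t ↦ ?_)
  rw [← Curve.map_reparam]
  refine le_of_lt (hδε ?_ ⟨t, rfl⟩)
  exact (ContinuousMap.dist_apply_le_dist (f := γ₁.toContinuousMap)
    (g := (γ₂.reparam φ).toContinuousMap) t).trans_lt hφ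

/-- Pushing curve classes forward along a continuous map is continuous. [folklore] -/
theorem CurveClass.continuous_map (f : C(E, F)) : Continuous (CurveClass.map f) := by
  unfold CurveClass.map
  exact SeparationQuotient.continuous_lift_iff.2
    (CurveClass.continuous_mk.comp (Curve.continuous_map f))

/-- Pushing curve classes forward along a continuous map is Borel measurable (so that image laws
`Φ_* μ = μ.map (CurveClass.map Φ)` do not degenerate). [folklore] -/
theorem CurveClass.measurable_map (f : C(E, F)) : Measurable (CurveClass.map f) :=
  (CurveClass.continuous_map f).measurable

end MapContinuous

/-! ### Two Borel events on curve space -/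

namespace CurveClass

variable {E : Type*} [MetricSpace E]

/-- Staying inside an OPEN set is an open event: a compact trace inside `U` has a uniform
neighbourhood inside `U`, and nearby classes have traces in that neighbourhood
(Aizenman–Burchard 1999, §2.1, curve-space topology). [folklore] -/
theorem isOpen_rangeSubset {U : Set E} (hU : IsOpen U) : IsOpen (rangeSubset U) := by
  rw [Metric.isOpen_iff]
  intro c hc
  obtain ⟨γ, rfl⟩ := surjective_mk c
  rw [mem_rangeSubset, range_mk] at hc
  obtain ⟨δ, hδ, hsub⟩ := γ.isCompact_range.exists_thickening_subset_open hU hc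
  refine ⟨δ, hδ, fun c' hc' ↦ ?_⟩
  obtain ⟨γ', rfl⟩ := surjective_mk c'
  rw [Metric.mem_ball, dist_mk_mk] at hc'
  rw [mk_mem_rangeSubset]
  intro t
  apply hsub
  rw [Metric.mem_thickening_iff_infDist_lt γ.range_nonempty]
  exact (Curve.infDist_range_le γ' γ t).trans_lt hc'

/-- Staying inside an open set is a Borel event. [folklore] -/
theorem measurableSet_rangeSubset_of_isOpen {U : Set E} (hU : IsOpen U) :
    MeasurableSet (rangeSubset U) :=
  (isOpen_rangeSubset hU).measurableSet

/-- The event "the trace meets the closed set `F` only inside the closed set `C`"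
(`{c | c.range ∩ F ⊆ C}`; used with `F = ∂D`, `C = {a, b}`) is Borel: it is the countable
intersection of the open events "the trace stays in `Fᶜ ∪ {infDist(·, C) < 1/(n+1)}`". [folklore] -/
theorem measurableSet_range_inter_subset {F C : Set E} (hF : IsClosed F) (hC : IsClosed C) :
    MeasurableSet {c : CurveClass E | c.range ∩ F ⊆ C} := by
  rcases C.eq_empty_or_nonempty with rfl | hCne
  · have h : {c : CurveClass E | c.range ∩ F ⊆ ∅} = rangeSubset Fᶜ := by
      ext c
      simp only [mem_setOf_eq, mem_rangeSubset, subset_empty_iff, subset_compl_iff_disjoint_right,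
        disjoint_iff_inter_eq_empty]
    rw [h]
    exact measurableSet_rangeSubset_of_isOpen hF.isOpen_compl
  · have h : {c : CurveClass E | c.range ∩ F ⊆ C} =
        ⋂ n : ℕ, rangeSubset (Fᶜ ∪ {x | Metric.infDist x C < 1 / (n + 1 : ℝ)}) := by
      ext c
      simp only [mem_setOf_eq, mem_iInter, mem_rangeSubset]
      constructor
      · rintro h n x hx
        by_cases hxF : x ∈ F
        · refine Or.inr ?_
          rw [mem_setOf_eq, Metric.infDist_zero_of_mem (h ⟨hx, hxF⟩)]
          positivity
        · exact Or.inl hxF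
      · rintro h x ⟨hx, hxF⟩
        by_contra hxC
        obtain ⟨n, hn⟩ := exists_nat_one_div_lt ((hC.notMem_iff_infDist_pos hCne).1 hxC)
        rcases h n hx with hxF' | hlt
        · exact hxF' hxF
        · exact lt_asymm hn hlt
    rw [h]
    exact MeasurableSet.iInter fun n ↦ measurableSet_rangeSubset_of_isOpen
      (hF.isOpen_compl.union (isOpen_lt (Metric.continuous_infDist_pt C) continuous_const))

end CurveClass

/-! ### Hull subdomains of a Dobrushin domain (the transposed `𝒬*`) -/

namespace MarkedDomain

/-- `D'` is a **hull subdomain** of the Dobrushin domain `(D; a, b)`: a Dobrushin domain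
`D' ⊆ D` with the same marked points `a`, `b` such that the removed part `D ∖ D'` stays away
from both marked points (`a, b ∉ closure (D ∖ D')`). Under a chordal uniformizing map
`φ : (ℍ; 0, ∞) → (D; a, b)` these are exactly the domains `φ(ℍ ∖ A)` for the hulls `A ∈ 𝒬*` of
[LSW] §2 (pp. 7–8: "`𝒬` = bounded `A ⊂ ℍ̄` with `A = cl(A ∩ ℍ)` and `ℍ ∖ A` simply connected;
`𝒬*` = those with `0 ∉ A`") whose complement `ℍ ∖ A` is a Jordan domain of the sphere — in
particular for all smooth hulls (`A` bounded ⟺ `b ∉ cl(D ∖ D')`; `0 ∉ A` ⟺ `a ∉ cl(D ∖ D')`).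
[cite: LawlerSchrammWerner2003Restriction, §2 pp. 7–8 (𝒬, 𝒬*), transposed] -/
def IsHullSubdomain (D D' : MarkedDomain 2) : Prop :=
  D'.carrier ⊆ D.carrier ∧ D'.pt 0 = D.pt 0 ∧ D'.pt 1 = D.pt 1 ∧
    D.pt 0 ∉ closure (D.carrier \ D'.carrier) ∧ D.pt 1 ∉ closure (D.carrier \ D'.carrier)

variable {D D' : MarkedDomain 2}

/-- A hull subdomain is a subdomain. [folklore] -/
theorem IsHullSubdomain.carrier_subset (h : D.IsHullSubdomain D') : D'.carrier ⊆ D.carrier :=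
  h.1

/-- A hull subdomain has the same first marked point. [folklore] -/
theorem IsHullSubdomain.pt_zero_eq (h : D.IsHullSubdomain D') : D'.pt 0 = D.pt 0 :=
  h.2.1

/-- A hull subdomain has the same second marked point. [folklore] -/
theorem IsHullSubdomain.pt_one_eq (h : D.IsHullSubdomain D') : D'.pt 1 = D.pt 1 :=
  h.2.2.1

/-- The removed part of a hull subdomain stays away from `a`. [folklore] -/
theorem IsHullSubdomain.pt_zero_notMem (h : D.IsHullSubdomain D') :
    D.pt 0 ∉ closure (D.carrier \ D'.carrier) :=
  h.2.2.2.1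

/-- The removed part of a hull subdomain stays away from `b`. [folklore] -/
theorem IsHullSubdomain.pt_one_notMem (h : D.IsHullSubdomain D') :
    D.pt 1 ∉ closure (D.carrier \ D'.carrier) :=
  h.2.2.2.2

/-- Near each marked point a hull subdomain agrees with the domain ("`A` is bounded and bounded
away from the origin", [LSW] §1). [folklore] -/
theorem IsHullSubdomain.eventually_mem (h : D.IsHullSubdomain D') (i : Fin 2) :
    ∀ᶠ z in 𝓝 (D.pt i), z ∈ D.carrier → z ∈ D'.carrier := by
  have hi : D.pt i ∉ closure (D.carrier \ D'.carrier) := by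
    fin_cases i
    · exact h.pt_zero_notMem
    · exact h.pt_one_notMem
  filter_upwards [isClosed_closure.isOpen_compl.mem_nhds hi] with z hz hzD
  by_contra hzD'
  exact hz (subset_closure ⟨hzD, hzD'⟩)

/-- Every Dobrushin domain is a hull subdomain of itself (`A = ∅`; non-vacuity). [folklore] -/
theorem isHullSubdomain_self (D : MarkedDomain 2) : D.IsHullSubdomain D := by
  refine ⟨Subset.rfl, rfl, rfl, ?_, ?_⟩ <;> simp

end MarkedDomain

/-! ### Restriction over hull subdomains; families carried by simple curves -/

namespace ChordalFamily

/-- **Two-sided restriction over hull subdomains** — [LSW]'s `𝒜₁`-covariance (§2 p. 9 with §3: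
"the law of `K` restricted to `{K ∩ A = ∅}` equals `P[K ∩ A = ∅]` times the law of `Φ_A⁻¹(K)`",
`A ∈ 𝒬*`), transposed to a chordal family exactly as `ChordalFamily.IsRestriction` but quantified
only over HULL subdomains `D'` of `D` (`MarkedDomain.IsHullSubdomain`: `D ∖ D'` away from `a` and
`b`, i.e. `A` bounded and bounded away from `0`), which is the paper's hypothesis:
`P D' (T) · P D {γ ⊆ D̄'} = P D (T ∩ {γ ⊆ D̄'})`. Weaker than `IsRestriction`
(`IsRestriction.isHullRestriction`). [cite: LawlerSchrammWerner2003Restriction, §2 p. 9 and Prop. 3.3 (1)] -/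
def IsHullRestriction (P : ChordalFamily) : Prop :=
  ∀ (D D' : DobrushinDomain), D.IsHullSubdomain D' →
    ∀ T : Set (CurveClass ℂ), MeasurableSet T →
      P D' T * P D (CurveClass.rangeSubset (closure D'.carrier)) =
        P D (T ∩ CurveClass.rangeSubset (closure D'.carrier))

/-- The tree's restriction property (all subdomains with the same marked points) implies
restriction over hull subdomains. [folklore] -/
theorem IsRestriction.isHullRestriction {P : ChordalFamily} (h : P.IsRestriction) :
    P.IsHullRestriction :=
  fun D D' hD T hT ↦ h D D' hD.carrier_subset hD.pt_zero_eq hD.pt_one_eq T hT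

/-- `tipFamily` satisfies restriction over hull subdomains (non-vacuity). [folklore] -/
theorem isHullRestriction_tipFamily : tipFamily.IsHullRestriction :=
  isRestriction_tipFamily.isHullRestriction

/-- `P` is **carried by simple curves meeting the boundary only at the marked points**: for every
`(D; a, b)`, `P D`-a.e. curve class is simple and its trace meets `∂D` only inside `{a, b}`
([LSW] Def. 3.1 with "supported on simple curves", p. 5: `K` a simple curve, `K ∩ ℝ = {0}`).
This is the clause inlined in `Literature.Probability.RandomPlanarGeometry.LawlerSchrammWerner2003`. [cite: LawlerSchrammWerner2003Restriction, Def. 3.1 and p. 5 result 2] -/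
def IsCarriedBySimpleCurves (P : ChordalFamily) : Prop :=
  ∀ D : DobrushinDomain, ∀ᵐ γ ∂(P D),
    γ ∈ CurveClass.simple ∧ γ.range ∩ frontier D.carrier ⊆ {D.pt 0, D.pt 1}

end ChordalFamily

/-! ### Elementary properties of the chordal SLE laws (proved) -/

section SLELaw

variable {κ : ℝ≥0} {D : DobrushinDomain} {μ : Measure (CurveClass ℂ)}

/-- The SLE trace starts at the origin: `γ(0) = W₀ = 0`. [folklore] -/
@[simp] theorem sleTrace_zero (κ : ℝ≥0) (ω : ℝ≥0 → ℝ) : sleTrace κ ω 0 = 0 := by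
  change Loewner.trace (sleDriving κ ω) 0 = 0
  rw [Loewner.trace_zero, sleDriving_zero, Complex.ofReal_zero]

/-- The boundary extension of a chordal uniformizing map sends `0` to `a`. [folklore] -/
theorem MarkedDomain.IsChordalUniformizing.boundaryExtension_zero
    {φ : ConformalEquiv upperHalfPlaneSet D.carrier} (hφ : D.IsChordalUniformizing φ) :
    φ.boundaryExtension 0 = D.pt 0 :=
  φ.boundaryExtension_eq_of_hasBoundaryValue (by simp) hφ.1

/-- `rayParam` is injective on `[0, 1)`. [folklore] -/
theorem rayParam_injOn : InjOn rayParam {s : I | (s : ℝ) < 1} := by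
  intro s hs t ht hst
  have hs' : (1 : ℝ) - s ≠ 0 := (sub_pos.2 hs).ne'
  have ht' : (1 : ℝ) - t ≠ 0 := (sub_pos.2 ht).ne'
  have h : (s : ℝ) / (1 - s) = (t : ℝ) / (1 - t) := by
    simpa using congrArg (fun u : ℝ≥0 ↦ (u : ℝ)) hst
  rw [div_eq_div_iff hs' ht'] at h
  exact Subtype.ext (by linarith)

/-- A parameter of `[0, 1]` which is not `< 1` is `1`. [folklore] -/
theorem unitInterval.eq_one_of_not_lt {s : I} (hs : ¬ (s : ℝ) < 1) : s = 1 :=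
  Subtype.ext (le_antisymm s.2.2 (not_lt.1 hs))

/-- **SLE curves run from `a` to `b` inside `D̄`.** If `μ` is a chordal SLE_κ law in `(D; a, b)`
then `μ`-a.e. curve class starts at `a`, ends at `b` and has its trace in `closure D`: the trace
of the Loewner chain lies in `ℍ̄` and starts at `W₀ = 0`, the uniformizing map has boundary
value `a` at `0`, and its boundary extension maps `ℍ̄` into `D̄` (Carathéodory, hypothesis `h₈`
= `JordanDomain.mapsTo_boundaryExtension`); the endpoint `b` is prescribed by the time
compactification. Lawler (2005), §6.3. [cite: Lawler2005, §6.3] -/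
theorem IsSLELaw.ae_endpoints (h₈ : JordanDomain.mapsTo_boundaryExtension) (h : IsSLELaw κ D μ) :
    ∀ᵐ γ ∂μ, γ.source = D.pt 0 ∧ γ.target = D.pt 1 ∧ γ.range ⊆ closure D.carrier := by
  obtain ⟨Γ, ⟨hΓm, φ, hφ, hae⟩, rfl⟩ := h
  have hmeas : MeasurableSet {γ : CurveClass ℂ |
      γ.source = D.pt 0 ∧ γ.target = D.pt 1 ∧ γ.range ⊆ closure D.carrier} :=
    (CurveClass.continuous_source.measurable (measurableSet_singleton _)).inter
      ((CurveClass.continuous_target.measurable (measurableSet_singleton _)).inter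
        (CurveClass.measurableSet_rangeSubset isClosed_closure))
  rw [ae_map_iff hΓm hmeas]
  filter_upwards [hae] with ω ⟨hgen, c, hΓω, hc⟩
  rw [hΓω, CurveClass.source_mk, CurveClass.target_mk, CurveClass.range_mk]
  refine ⟨?_, hc.2, ?_⟩
  · rw [Curve.source_def, hc.1 0 (by norm_num), rayParam_zero, sleTrace_zero,
      hφ.boundaryExtension_zero]
  · rintro _ ⟨s, rfl⟩
    by_cases hs : (s : ℝ) < 1
    · rw [hc.1 s hs]
      refine h₈ D.toJordanDomain φ ?_
      rw [show closure upperHalfPlaneSet = {z : ℂ | 0 ≤ z.im} from Complex.closure_setOf_lt_im 0]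
      exact hgen.2.2.1 _
    · rw [unitInterval.eq_one_of_not_lt hs, hc.2]
      exact frontier_subset_closure (D.pt_mem_frontier 1)

/-- **SLE_κ curves, `0 < κ ≤ 4`, are simple and touch `∂D` only at `a` and `b`.** If `μ` is a
chordal SLE_κ law in `(D; a, b)` with `0 < κ ≤ 4` then `μ`-a.e. curve class is simple and its
trace meets `∂D` only inside `{a, b}`. From the Rohde–Schramm theorem "for `κ ∈ [0, 4]` the trace
is a simple path in `ℍ ∪ {0}`" (RS05 Thm. 6.1; hypothesis `h₆` =
`CritPerc.ae_isSimpleTrace_sleTrace_of_le_four`): the uniformizing map is injective on `ℍₒ` with values in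
the open set `D`, its boundary extension sends `0 ↦ a ∉ D`, and the compactification adds the
single point `b ∉ D ∪ {a}`; the Borel measurability of the simple classes (hypothesis `h₉` =
`CurveClass.measurableSet_simple`, Aizenman–Burchard) transports the statement to the law.
[cite: RohdeSchramm2005, Thm. 6.1] -/
theorem IsSLELaw.ae_simple (h₆ : RandomPlanarGeometry.ae_isSimpleTrace_sleTrace_of_le_four (κ := κ))
    (h₉ : CurveClass.measurableSet_simple (E := ℂ)) (h0 : 0 < κ) (h4 : κ ≤ 4)
    (h : IsSLELaw κ D μ) :
    ∀ᵐ γ ∂μ, γ ∈ CurveClass.simple ∧ γ.range ∩ frontier D.carrier ⊆ {D.pt 0, D.pt 1} := by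
  obtain ⟨Γ, ⟨hΓm, φ, hφ, hae⟩, rfl⟩ := h
  have hmeas : MeasurableSet {γ : CurveClass ℂ |
      γ ∈ CurveClass.simple ∧ γ.range ∩ frontier D.carrier ⊆ {D.pt 0, D.pt 1}} :=
    MeasurableSet.inter h₉ (CurveClass.measurableSet_range_inter_subset isClosed_frontier
      ((isClosed_singleton (x := D.pt 0)).union (isClosed_singleton (x := D.pt 1))))
  rw [ae_map_iff hΓm hmeas]
  filter_upwards [hae, h₆ h0 h4] with ω ⟨hgen, c, hΓω, hc⟩ hsimple
  -- `a ∉ D`, `b ∉ D`, `a ≠ b`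
  have hD : IsOpen D.carrier := D.isOpen
  have hnot : ∀ i : Fin 2, D.pt i ∉ D.carrier := fun i hi ↦
    (D.pt_mem_frontier i).2 (by rwa [hD.interior_eq])
  have hab : D.pt 0 ≠ D.pt 1 := fun h ↦ absurd (D.pt_injective h) (by decide)
  -- the map `f = Φ ∘ γ` on `[0, ∞)`: `f 0 = a`, `f t ∈ D` for `t > 0`, `f` injective
  set f : ℝ≥0 → ℂ := fun t ↦ φ.boundaryExtension (sleTrace κ ω t) with hf
  have hf0 : f 0 = D.pt 0 := by simp [hf, hφ.boundaryExtension_zero]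
  have hmemH : ∀ t : ℝ≥0, 0 < t → sleTrace κ ω t ∈ upperHalfPlaneSet := fun t ht ↦ hsimple.2 t ht
  have hfpos : ∀ t : ℝ≥0, 0 < t → f t = φ (sleTrace κ ω t) := fun t ht ↦
    φ.boundaryExtension_eq (hmemH t ht)
  have hfD : ∀ t : ℝ≥0, 0 < t → f t ∈ D.carrier := fun t ht ↦ by
    rw [hfpos t ht]
    exact φ.mapsTo (hmemH t ht)
  have hfinj : Function.Injective f := by
    intro u v huv
    rcases eq_or_ne u 0 with rfl | hu
    · rcases eq_or_ne v 0 with rfl | hv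
      · rfl
      · exact absurd (hf0 ▸ huv ▸ hfD v (pos_iff_ne_zero.2 hv)) (hnot 0)
    · rcases eq_or_ne v 0 with rfl | hv
      · exact absurd (hf0 ▸ huv ▸ hfD u (pos_iff_ne_zero.2 hu)) (hnot 0)
      · have hu' := pos_iff_ne_zero.2 hu
        have hv' := pos_iff_ne_zero.2 hv
        rw [hfpos u hu', hfpos v hv'] at huv
        exact hsimple.1 (φ.injOn (hmemH u hu') (hmemH v hv') huv)
  -- values of the compactified curve
  have hclt : ∀ s : I, (s : ℝ) < 1 → c s = f (rayParam s) := fun s hs ↦ hc.1 s hs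
  have hcmem : ∀ s : I, (s : ℝ) < 1 → c s = D.pt 0 ∨ c s ∈ D.carrier := fun s hs ↦ by
    rw [hclt s hs]
    rcases eq_or_ne (rayParam s) 0 with h0 | hne
    · exact Or.inl (h0 ▸ hf0)
    · exact Or.inr (hfD _ (pos_iff_ne_zero.2 hne))
  rw [hΓω]
  refine ⟨CurveClass.mk_mem_simple ?_, ?_⟩
  · -- injectivity of `c`
    intro s t hst
    by_cases hs : (s : ℝ) < 1 <;> by_cases ht : (t : ℝ) < 1
    · rw [hclt s hs, hclt t ht] at hst
      exact rayParam_injOn hs ht (hfinj hst)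
    · rw [unitInterval.eq_one_of_not_lt ht, hc.2] at hst
      rcases hcmem s hs with h | h
      · exact absurd (h.symm.trans hst) hab
      · exact absurd (hst ▸ h) (hnot 1)
    · rw [unitInterval.eq_one_of_not_lt hs, hc.2] at hst
      rcases hcmem t ht with h | h
      · exact absurd (h.symm.trans hst.symm) hab
      · exact absurd (hst ▸ h) (hnot 1)
    · rw [unitInterval.eq_one_of_not_lt hs, unitInterval.eq_one_of_not_lt ht]
  · -- the trace meets `∂D` only at `a`, `b`
    rw [CurveClass.range_mk]
    rintro _ ⟨⟨s, rfl⟩, hx⟩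
    by_cases hs : (s : ℝ) < 1
    · rcases hcmem s hs with h | h
      · exact Or.inl h
      · exact absurd (by rwa [hD.interior_eq]) hx.2
    · rw [unitInterval.eq_one_of_not_lt hs, hc.2]
      exact Or.inr rfl

end SLELaw

/-! ### The deep inputs, as named facts -/

/-- NAMED FACT — **conformal covariance of the chordal SLE_κ laws between Dobrushin domains.**
If `μ` is a chordal SLE_κ law in `(D; a, b)`, `μ'` one in `(D'; a', b')`, `g : D → D'` is a
conformal equivalence with boundary values `a ↦ a'`, `b ↦ b'`, and `Φ : ℂ → ℂ` is continuous
and agrees with `g` on `D`, then `μ' = Φ_* μ`. (Chordal SLE in a domain is DEFINED as the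
conformal image of SLE in `(ℍ; 0, ∞)`, well defined by scale invariance: `g ∘ φ` is a chordal
uniformizing map of `D'` whenever `φ` is one of `D`, `Φ ∘ φ̄ = \overline{g ∘ φ}` on `ℍ̄` by
continuity, so `Φ_* μ` is an SLE_κ law in `D'`, equal to `μ'` by the uniqueness
`IsSLECurve.map_eq`.) This is the cross-domain form of the tree's `IsSLECurve.map_eq`, PROVED
from it below (`IsSLELaw.conformalCovariance_of_facts`); it is "conformal invariance" in Schramm
(2000) §1 and Lawler (2005) §6.3, and hypothesis (1) of Werner's axiomatic characterisation
(Werner 2007 §3.2 (1)). [cite: Lawler2005, §6.3 (chordal SLE in a simply connected domain, well defined by scaling)] -/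
def IsSLELaw.conformalCovariance : Prop :=
  ∀ {κ : ℝ≥0} (D D' : DobrushinDomain) (g : ConformalEquiv D.carrier D'.carrier) (Φ : C(ℂ, ℂ))
    {μ μ' : Measure (CurveClass ℂ)}, IsSLELaw κ D μ → IsSLELaw κ D' μ' →
    g.HasBoundaryValue (D.pt 0) (D'.pt 0) → g.HasBoundaryValue (D.pt 1) (D'.pt 1) →
    EqOn Φ g D.carrier → μ' = μ.map (CurveClass.map Φ)

section Covariance

variable {U V : Set ℂ}

/-- A conformal equivalence which agrees on its source with a continuous map `Φ` of the plane
has boundary value `Φ x` at every point `x`. [folklore] -/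
theorem ConformalEquiv.hasBoundaryValue_of_eqOn (g : ConformalEquiv U V) {Φ : C(ℂ, ℂ)}
    (hΦ : EqOn Φ g U) (x : ℂ) : g.HasBoundaryValue x (Φ x) :=
  ((Φ.continuous.tendsto x).mono_left nhdsWithin_le_nhds).congr'
    (eventually_nhdsWithin_of_forall fun _ hz ↦ hΦ hz)

/-- Hence a prescribed boundary value of `g` at a point of `closure U` is the value of `Φ` there.
[folklore] -/
theorem ConformalEquiv.eq_of_hasBoundaryValue_of_eqOn (g : ConformalEquiv U V) {Φ : C(ℂ, ℂ)}
    (hΦ : EqOn Φ g U) {x p : ℂ} (hx : x ∈ closure U) (hg : g.HasBoundaryValue x p) : Φ x = p :=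
  haveI : (𝓝[U] x).NeBot := mem_closure_iff_nhdsWithin_neBot.1 hx
  tendsto_nhds_unique (g.hasBoundaryValue_of_eqOn hΦ x) hg

variable {D D' : DobrushinDomain}

/-- Post-composing a chordal uniformizing map `φ : ℍₒ → (D; a, b)` with a conformal equivalence
`g : D → D'` having boundary values `a ↦ a'`, `b ↦ b'` gives a chordal uniformizing map of
`(D'; a', b')`. Lawler (2005), §6.3. [folklore] -/
theorem MarkedDomain.IsChordalUniformizing.trans {φ : ConformalEquiv upperHalfPlaneSet D.carrier}
    (hφ : D.IsChordalUniformizing φ) (g : ConformalEquiv D.carrier D'.carrier)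
    (h0 : g.HasBoundaryValue (D.pt 0) (D'.pt 0)) (h1 : g.HasBoundaryValue (D.pt 1) (D'.pt 1)) :
    D'.IsChordalUniformizing (φ.trans g) := by
  refine ⟨?_, ?_⟩
  · have hφ' : Tendsto φ (𝓝[upperHalfPlaneSet] 0) (𝓝[D.carrier] (D.pt 0)) :=
      tendsto_nhdsWithin_iff.2 ⟨hφ.1, eventually_nhdsWithin_of_forall fun z hz ↦ φ.mapsTo hz⟩
    exact h0.comp hφ'
  · have hφ' : Tendsto φ (cocompact ℂ ⊓ 𝓟 upperHalfPlaneSet) (𝓝[D.carrier] (D.pt 1)) :=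
      tendsto_nhdsWithin_iff.2 ⟨hφ.2, mem_inf_of_right (mem_principal.2 fun z hz ↦ φ.mapsTo hz)⟩
    exact h1.comp hφ'

/-- On the closed half-plane, the boundary extension of `g ∘ φ` is `Φ ∘` (boundary extension of
`φ`), for `Φ` continuous agreeing with `g` on `D` — given that `φ` HAS boundary values at real
points (Carathéodory, hypothesis `h₅` = `JordanDomain.exists_hasBoundaryValue`). [folklore] -/
theorem ConformalEquiv.boundaryExtension_trans_eq (h₅ : JordanDomain.exists_hasBoundaryValue)
    (φ : ConformalEquiv upperHalfPlaneSet D.carrier) (g : ConformalEquiv D.carrier D'.carrier)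
    {Φ : C(ℂ, ℂ)} (hΦ : EqOn Φ g D.carrier) {z : ℂ} (hz : z ∈ closure upperHalfPlaneSet) :
    (φ.trans g).boundaryExtension z = Φ (φ.boundaryExtension z) := by
  -- `φ` has some boundary value `p` at `z`
  obtain ⟨p, hp⟩ : ∃ p, φ.HasBoundaryValue z p := by
    by_cases hzH : z ∈ upperHalfPlaneSet
    · exact ⟨φ z, φ.hasBoundaryValue_apply hzH⟩
    · have hz0 : z.im = 0 := by
        have h1 : 0 ≤ z.im := by
          rw [show closure upperHalfPlaneSet = {z : ℂ | 0 ≤ z.im} from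
            Complex.closure_setOf_lt_im 0] at hz
          exact hz
        have h2 : ¬ 0 < z.im := hzH
        linarith [not_lt.1 h2]
      obtain ⟨p, -, hp⟩ := h₅ D.toJordanDomain φ z.re
      refine ⟨p, ?_⟩
      convert hp using 2
      exact Complex.ext (by simp) (by simp [hz0])
  rw [φ.boundaryExtension_eq_of_hasBoundaryValue hz hp]
  refine (φ.trans g).boundaryExtension_eq_of_hasBoundaryValue hz ?_
  -- `g ∘ φ = Φ ∘ φ` on `ℍₒ`, and `Φ ∘ φ → Φ p`
  have h : Tendsto (fun w ↦ Φ (φ w)) (𝓝[upperHalfPlaneSet] z) (𝓝 (Φ p)) :=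
    (Φ.continuous.tendsto p).comp hp
  refine h.congr' (eventually_nhdsWithin_of_forall fun w hw ↦ ?_)
  rw [ConformalEquiv.trans_apply]
  exact hΦ (φ.mapsTo hw)

/-- **The image of a chordal SLE_κ random curve under a conformal equivalence of Dobrushin domains
is a chordal SLE_κ random curve** (with respect to the composed uniformizing map): the
book-keeping behind "chordal SLE in `D'` is the conformal image of chordal SLE in `D`". Uses
Carathéodory (`h₅`) for the boundary values of the uniformizing map and the continuity of
`CurveClass.map Φ`. Lawler (2005), §6.3. [cite: Lawler2005, §6.3] -/
theorem IsSLECurve.map (h₅ : JordanDomain.exists_hasBoundaryValue) {κ : ℝ≥0}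
    {Γ : (ℝ≥0 → ℝ) → CurveClass ℂ} (hΓ : IsSLECurve κ D Γ)
    (g : ConformalEquiv D.carrier D'.carrier) {Φ : C(ℂ, ℂ)}
    (h0 : g.HasBoundaryValue (D.pt 0) (D'.pt 0)) (h1 : g.HasBoundaryValue (D.pt 1) (D'.pt 1))
    (hΦ : EqOn Φ g D.carrier) : IsSLECurve κ D' (CurveClass.map Φ ∘ Γ) := by
  obtain ⟨hΓm, φ, hφ, hae⟩ := hΓ
  refine ⟨(CurveClass.measurable_map Φ).comp_aemeasurable hΓm, φ.trans g, hφ.trans g h0 h1, ?_⟩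
  have hb : Φ (D.pt 1) = D'.pt 1 :=
    g.eq_of_hasBoundaryValue_of_eqOn hΦ (frontier_subset_closure (D.pt_mem_frontier 1)) h1
  filter_upwards [hae] with ω ⟨hgen, c, hΓω, hc⟩
  refine ⟨hgen, c.map Φ, by rw [Function.comp_apply, hΓω, CurveClass.map_mk], ?_, ?_⟩
  · intro s hs
    rw [Curve.map_apply, hc.1 s hs, ConformalEquiv.boundaryExtension_trans_eq h₅ φ g hΦ]
    rw [show closure upperHalfPlaneSet = {z : ℂ | 0 ≤ z.im} from Complex.closure_setOf_lt_im 0]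
    exact hgen.2.2.1 _
  · rw [Curve.map_apply, hc.2, hb]

/-- **`IsSLELaw.conformalCovariance` from the tree's facts**: uniqueness of the SLE law in a
domain (`IsSLECurve.map_eq`, hypothesis `h₃`; itself reduced to Brownian scaling in `SLEProofs`)
and Carathéodory's boundary values (`JordanDomain.exists_hasBoundaryValue`, `h₅`).
Lawler (2005), §6.3. [cite: Lawler2005, §6.3] -/
theorem IsSLELaw.conformalCovariance_of_facts (h₃ : IsSLECurve.map_eq)
    (h₅ : JordanDomain.exists_hasBoundaryValue) : IsSLELaw.conformalCovariance := by
  intro κ D D' g Φ μ μ' hμ hμ' h0 h1 hΦ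
  obtain ⟨Γ, hΓ, rfl⟩ := hμ
  obtain ⟨Γ', hΓ', rfl⟩ := hμ'
  rw [AEMeasurable.map_map_of_aemeasurable (CurveClass.measurable_map Φ).aemeasurable
    hΓ.aemeasurable]
  exact h₃ hΓ' (hΓ.map h₅ g h0 h1 hΦ)

end Covariance

/-- NAMED FACT — **[LSW] Theorem 6.1 (restriction property of SLE_{8/3}), transposed.** "Let `γ`
be the SLE_{8/3} path starting at the origin and `A ∈ 𝒬*`, then
`P[γ[0, ∞) ∩ A = ∅] = Φ'_A(0)^{5/8}`. The law of `γ(0, ∞)` is therefore `P_{5/8}`" — in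
particular (Prop. 3.3 (3) ⇒ (1)) the law of `γ` is `𝒜₁`-covariant: conditionally on
`{γ ∩ A = ∅}`, `γ` has the law of `Φ_A⁻¹(γ)`, which is chordal SLE_{8/3} in `(ℍ ∖ A; 0, ∞)`.
Transposed with the dictionary of the module docstring (hull subdomains `D' = φ(ℍ ∖ A)`;
`{γ ⊆ D̄'}` and `{γ ∩ A = ∅}` differ by a null event, by Thm. 6.1 itself and the continuity of
`A ↦ Φ'_A(0)` under exhaustion of `A°`): if `μ`, `μ'` are the chordal SLE_{8/3} laws of `D` and of
a hull subdomain `D'`, then `μ' (T) · μ {γ ⊆ D̄'} = μ (T ∩ {γ ⊆ D̄'})` for every Borel `T`.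
[cite: LawlerSchrammWerner2003Restriction, Thm. 6.1 (p. 23) with Prop. 3.3] -/
def IsSLELaw.hullRestriction_eightThirds : Prop :=
  ∀ (D D' : DobrushinDomain) {μ μ' : Measure (CurveClass ℂ)},
    IsSLELaw ((8 : ℝ≥0) / 3) D μ → IsSLELaw ((8 : ℝ≥0) / 3) D' μ' → D.IsHullSubdomain D' →
    ∀ T : Set (CurveClass ℂ), MeasurableSet T →
      μ' T * μ (CurveClass.rangeSubset (closure D'.carrier)) =
        μ (T ∩ CurveClass.rangeSubset (closure D'.carrier))

/-- NAMED FACT — **[LSW] p. 5 result 2, uniqueness half: there is at most one restriction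
family carried by simple curves.** Two chordal families which are both chordal, conformally
covariant, satisfy two-sided restriction over hull subdomains and are carried by simple curves
meeting the boundary only at the marked points coincide in every Dobrushin domain. In the paper:
pulled back to `(ℍ; 0, ∞)` by a chordal uniformizing map, each `P D` is a probability measure on
`Ω` (Def. 3.1) which is dilation-invariant (covariance under the conformal automorphisms of `D`
fixing `a`, `b`) and `𝒜₁`-covariant (restriction over the hull subdomains `φ(ℍ ∖ A)`, `A` smooth,
upgraded to all `A ∈ 𝒬*` by Lemma 2.1), hence equals `P_α` for a unique `α` (Prop. 3.3 with
Lemma 3.2); being carried by simple curves forces `α = 5/8` (Thm. 7.3: for `α > 5/8`, `P_α`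
charges sets with interior — the filled Brownian bubbles; Cor. 8.6: no `P_α` for `α < 5/8`); so
both pull-backs are `P_{5/8}` as laws of the trace, and a law on simple curve classes with fixed
endpoints is determined by the law of the trace.
[cite: LawlerSchrammWerner2003Restriction, p. 5 result 2; Prop. 3.3 with Lemma 3.2 (pp. 10–11), Thm. 7.3 (p. 29), Cor. 8.6 (p. 37)] -/
def LawlerSchrammWerner2003_unique : Prop :=
  ∀ P Q : ChordalFamily,
    P.IsChordal → P.IsConformallyCovariant → P.IsHullRestriction → P.IsCarriedBySimpleCurves →
    Q.IsChordal → Q.IsConformallyCovariant → Q.IsHullRestriction → Q.IsCarriedBySimpleCurves →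
    ∀ D : DobrushinDomain, P D = Q D

/-! ### Assembly -/

/-- **The SLE_{8/3} family.** Given the existence of chordal SLE curves (`exists_isSLECurve`,
hypothesis `hex`), a choice, for every Dobrushin domain, of the law of a chordal SLE_{8/3} random
curve in it. [cite: LawlerSchrammWerner2003Restriction, Thm. 6.1 ("the law of γ(0,∞)")] -/
def sleEightThirdsFamily (hex : exists_isSLECurve) : ChordalFamily := fun D ↦
  Process.preWienerMeasure.map (hex (κ := 8 / 3) (by positivity) D).choose

/-- Each law of the SLE_{8/3} family is a chordal SLE_{8/3} law. [folklore] -/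
theorem isSLELaw_sleEightThirdsFamily (hex : exists_isSLECurve) (D : DobrushinDomain) :
    IsSLELaw ((8 : ℝ≥0) / 3) D (sleEightThirdsFamily hex D) :=
  (hex (κ := 8 / 3) (by positivity) D).choose_spec.isSLELaw_map

/-- **Existence half of [LSW] p. 5 result 2, assembled**: the SLE_{8/3} family is chordal,
conformally covariant, satisfies restriction over hull subdomains and is carried by simple curves
meeting the boundary only at the marked points — from the named facts
`IsSLECurve.map_eq` (`h₃`, uniqueness of the SLE law), `IsSLELaw.hullRestriction_eightThirds`
(`h₄`, Thm. 6.1), Carathéodory (`h₅`, `h₈`), Rohde–Schramm simplicity (`h₆`), Borel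
measurability of simple classes (`h₉`) and the standing Kolmogorov-extension fact
`isProjectiveLimit_preWienerMeasure` (`hW`, making the laws probability measures). [cite: LawlerSchrammWerner2003Restriction, Thm. 6.1 with [42] = Rohde–Schramm] -/
theorem sleEightThirdsFamily_spec (hW : Process.isProjectiveLimit_preWienerMeasure)
    (hex : exists_isSLECurve) (h₃ : IsSLECurve.map_eq) (h₄ : IsSLELaw.hullRestriction_eightThirds)
    (h₅ : JordanDomain.exists_hasBoundaryValue)
    (h₆ : RandomPlanarGeometry.ae_isSimpleTrace_sleTrace_of_le_four (κ := (8 : ℝ≥0) / 3))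
    (h₈ : JordanDomain.mapsTo_boundaryExtension) (h₉ : CurveClass.measurableSet_simple (E := ℂ)) :
    (sleEightThirdsFamily hex).IsChordal ∧ (sleEightThirdsFamily hex).IsConformallyCovariant ∧
      (sleEightThirdsFamily hex).IsHullRestriction ∧
      (sleEightThirdsFamily hex).IsCarriedBySimpleCurves := by
  haveI : Fact Process.isProjectiveLimit_preWienerMeasure := ⟨hW⟩
  have hQ := isSLELaw_sleEightThirdsFamily hex
  refine ⟨fun D ↦ ⟨(hQ D).isProbabilityMeasure, (hQ D).ae_endpoints h₈⟩,
    fun D D' g Φ h0 h1 hΦ ↦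
      IsSLELaw.conformalCovariance_of_facts h₃ h₅ D D' g Φ (hQ D) (hQ D') h0 h1 hΦ,
    fun D D' hDD' T hT ↦ h₄ D D' (hQ D) (hQ D') hDD' T hT,
    fun D ↦ (hQ D).ae_simple h₆ h₉ (by positivity) ?_⟩
  rw [div_le_iff₀ (by norm_num : (0 : ℝ≥0) < 3)]
  norm_num

/-- **`Literature.Probability.RandomPlanarGeometry.LawlerSchrammWerner2003` from its parts.** The named fact
`Literature.Probability.RandomPlanarGeometry.LawlerSchrammWerner2003` ([LSW] p. 5 result 2, transposed) follows from: uniqueness of the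
restriction family carried by simple curves (`LawlerSchrammWerner2003_unique`: Prop. 3.3,
Lemma 3.2, Thm. 7.3, Cor. 8.6), the restriction property of SLE_{8/3} (`h₄`: Thm. 6.1),
existence and uniqueness of the SLE curve (`hex`, `h₃`; Rohde–Schramm Thm. 5.1 with 7.1,
Brownian scaling), simplicity of the SLE_{8/3} trace (`h₆`, Rohde–Schramm Thm. 6.1),
Carathéodory's theorem (`h₅`, `h₈`), Borel measurability of simple classes (`h₉`) and the
Kolmogorov extension fact `hW`. Proof: a family `P` as in the statement satisfies restriction over hull
subdomains a fortiori, so it agrees with the SLE_{8/3} family in every domain.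
[cite: LawlerSchrammWerner2003Restriction, p. 5 result 2] -/
theorem LawlerSchrammWerner2003_of_facts (hW : Process.isProjectiveLimit_preWienerMeasure)
    (hex : exists_isSLECurve) (hU : LawlerSchrammWerner2003_unique) (h₃ : IsSLECurve.map_eq)
    (h₄ : IsSLELaw.hullRestriction_eightThirds) (h₅ : JordanDomain.exists_hasBoundaryValue)
    (h₆ : RandomPlanarGeometry.ae_isSimpleTrace_sleTrace_of_le_four (κ := (8 : ℝ≥0) / 3))
    (h₈ : JordanDomain.mapsTo_boundaryExtension) (h₉ : CurveClass.measurableSet_simple (E := ℂ)) :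
    LawlerSchrammWerner2003 := by
  intro P hP hcov hres hsimple D
  obtain ⟨hQc, hQcov, hQres, hQs⟩ := sleEightThirdsFamily_spec hW hex h₃ h₄ h₅ h₆ h₈ h₉
  have hPres : P.IsHullRestriction := ChordalFamily.IsRestriction.isHullRestriction hres
  rw [hU P (sleEightThirdsFamily hex) hP hcov hPres hsimple hQc hQcov hQres hQs D]
  exact isSLELaw_sleEightThirdsFamily hex D

end Literature.Probability.RandomPlanarGeometry

end
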